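import Summits.KontsevichZagierPeriods.KontsevichZagierPeriods.Theorems.PlanarAreas.Negative.Divisibility

/-!
# `PlanarAreas` (stmt-KontsevichZagierPeriods-4990): negative side — XI. SATURATION: the quotient by the moves is torsion-free (the torsion reading is void)

Negative-side support for the crux `PlanarAreas` (cdisprove cycle 3; running commentary in the work
file `Cruxes/PlanarAreas/Disproof.lean` §11).

Cycle 2 (`Negative/Divisibility.lean`, §6c) isolated ONE attack surface on the crux invisible to
every `ℝ`-valued invariant: TORSION in `KZ.FormalRep ⧸ KZ.relations` — an equal-area pair connected
"`k` times over" (`k • ([r] − [r']) ∈ relations`) but not once would refute the crux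
(`not_planarAreas_of_torsion`), and saturation of `relations` was only known as a CONSEQUENCE of the
kernel conjecture (`saturated_of_kzKernelConjecture`).

This file closes that surface unconditionally: **`KZ.relations` is saturated**
(`relationsSaturated : RelationsSaturated`), i.e. the quotient of the formal group by the moves is
TORSION-FREE; together with its divisibility (§6a) it is therefore a `ℚ`-vector space
(`existsUnique_div`).  The proof is two lines of structure:

* the **scaling endomorphisms** `scaleHom q : [σ, f] ↦ [σ, q • f]` (`q ∈ ℚ`) of `FormalRep` map each
  of the four move sets INTO ITSELF (`scaleHom_mem_domainAddRel`, `…integrandAddRel`,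
  `…changeOfVariablesRel`, `…newtonLeibnizRel`: scale every representation of the instance, and the
  primitive `F` of a Newton–Leibniz instance, by `q`), hence `relations` into `relations`
  (`scaleHom_mem_relations`);
* every formal combination satisfies `c ≡ k • scaleHom (1/k) c` modulo rule 1b
  (`sub_nsmul_scaleHom_mem_closure`, from §6a).
So `k • c ∈ relations ⇒ k • scaleHom (1/k) c = scaleHom (1/k) (k • c) ∈ relations ⇒ c ∈ relations`.

Consequences recorded: `nsmul_mem_relations_iff`, `zsmul_mem_relations_iff`,
`not_isOfFinAddOrder_of_not_mem` (no torsion in the quotient), `existsUnique_div` (unique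
divisibility), `no_torsion_witness` (the cycle-2 attack `not_planarAreas_of_torsion` can never be
instantiated), `equivalent_of_nsmul_sub_mem` (a `k`-fold chain between two representations is as
good as a chain).  For the provers: integer (hence rational) coefficients may be cleared freely when
transporting `ℚ̄`-linear period relations (Huber–Wüstholz's bilinearity (A)) into chains of moves.

Everything is sorry-free; axioms ⊆ {propext, Classical.choice, Quot.sound}.

Sources: M. Kontsevich, D. Zagier, *Periods* (2001), §1.2 (the three rules); L. Fuchs, *Infinite
Abelian Groups* I (1970), §§20–23 (divisible + torsion-free = `ℚ`-vector space) — folklore level. -/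

noncomputable section

open Set MeasureTheory MvPolynomial Filter Topology
open Literature.NumberTheory.Transcendental Literature.ModelTheory.ExponentialFields

namespace Summit.KontsevichZagierPeriods.PlanarAreas.Negative

open Summit.KontsevichZagierPeriods.KontsevichZagierPeriods.Theses.SymplecticScissors (PlanarAreas)
open Summit.KontsevichZagierPeriods.SymplecticScissors.RealOnePeriodRelationsNegative
  (isSemialgebraicFunOn_ratConst)

/-! ## §11a The scaling endomorphisms of the formal group -/

/-- **The scaling endomorphism** `S_q` of the formal group: `[σ, f] ↦ [σ, q • f]` on generators
(`q ∈ ℚ`), extended additively. [folklore] -/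
def scaleHom (q : ℚ) : KZ.FormalRep →+ KZ.FormalRep :=
  FreeAbelianGroup.lift fun x => KZ.of (scaleRep q x.2)

/-- `S_q [r] = [σ, q • f]`. [folklore] -/
@[simp] theorem scaleHom_of (q : ℚ) {n : ℕ} (r : KZ.IntegralRep n) :
    scaleHom q (KZ.of r) = KZ.of (scaleRep q r) :=
  FreeAbelianGroup.lift_apply_of _ _

/-- Rule 1a is stable under scaling: scale the three representations of the instance.
[cite: KontsevichZagier2001, §1.2 rule (1)] -/
theorem scaleHom_mem_domainAddRel (q : ℚ) {c : KZ.FormalRep} (hc : c ∈ KZ.domainAddRel) :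
    scaleHom q c ∈ KZ.domainAddRel := by
  obtain ⟨n, r, r₁, r₂, hdom, hnull, h₁, h₂, rfl⟩ := hc
  refine ⟨n, scaleRep q r, scaleRep q r₁, scaleRep q r₂, hdom, hnull, ?_, ?_, by simp [map_sub]⟩
  · intro x hx
    simp only [scaleRep_integrand, h₁ hx]
  · intro x hx
    simp only [scaleRep_integrand, h₂ hx]

/-- Rule 1b is stable under scaling. [cite: KontsevichZagier2001, §1.2 rule (1)] -/
theorem scaleHom_mem_integrandAddRel (q : ℚ) {c : KZ.FormalRep} (hc : c ∈ KZ.integrandAddRel) :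
    scaleHom q c ∈ KZ.integrandAddRel := by
  obtain ⟨n, r, r₁, r₂, h₁, h₂, hadd, rfl⟩ := hc
  refine ⟨n, scaleRep q r, scaleRep q r₁, scaleRep q r₂, h₁, h₂, ?_, by simp [map_sub]⟩
  intro x hx
  simp only [scaleRep_integrand, Pi.add_apply]
  rw [hadd hx, Pi.add_apply]
  ring

/-- Rule 2 is stable under scaling: same substitution `Φ`, both integrands scaled.
[cite: KontsevichZagier2001, §1.2 rule (2)] -/
theorem scaleHom_mem_changeOfVariablesRel (q : ℚ) {c : KZ.FormalRep}
    (hc : c ∈ KZ.changeOfVariablesRel) : scaleHom q c ∈ KZ.changeOfVariablesRel := by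
  obtain ⟨n, r, r', Φ, Φ', hΦ, hΦ', hinj, hdom, hf, rfl⟩ := hc
  refine ⟨n, scaleRep q r, scaleRep q r', Φ, Φ', hΦ, hΦ', hinj, hdom, ?_, by simp [map_sub]⟩
  intro x hx
  simp only [scaleRep_integrand]
  rw [hf x hx]
  ring

/-- Rule 3 is stable under scaling: scale the band representation, the base representation and
the primitive `F` by `q`. [cite: KontsevichZagier2001, §1.2 rule (3)] -/
theorem scaleHom_mem_newtonLeibnizRel (q : ℚ) {c : KZ.FormalRep} (hc : c ∈ KZ.newtonLeibnizRel) :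
    scaleHom q c ∈ KZ.newtonLeibnizRel := by
  obtain ⟨n, r, r', a, b, F, hF, ha, hb, hab, hdom, hcont, hder, hbase, rfl⟩ := hc
  refine ⟨n, scaleRep q r, scaleRep q r', a, b, fun z => (q : ℝ) * F z, ?_, ha, hb, hab, hdom,
    ?_, ?_, ?_, by simp [map_sub]⟩
  · exact IsSemialgebraicFunOn.mul_holds (isSemialgebraicFunOn_ratConst r.isSemialgebraic_domain q) hF
  · intro x hx
    exact continuousOn_const.mul (hcont x hx)
  · intro x hx t ht
    simpa only [scaleRep_integrand] using (hder x hx t ht).const_mul (q : ℝ)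
  · intro x hx
    simp only [scaleRep_integrand]
    rw [hbase x hx]
    ring

/-- **The scaling endomorphisms preserve the subgroup of relations.**
[cite: KontsevichZagier2001, §1.2] -/
theorem scaleHom_mem_relations (q : ℚ) {c : KZ.FormalRep} (hc : c ∈ KZ.relations) :
    scaleHom q c ∈ KZ.relations := by
  have h : KZ.relations.map (scaleHom q) ≤ KZ.relations := by
    rw [KZ.relations, AddMonoidHom.map_closure]
    refine (AddSubgroup.closure_le _).2 ?_
    rintro _ ⟨c, hc, rfl⟩
    apply AddSubgroup.subset_closure
    rcases hc with ((hc | hc) | hc) | hc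
    · exact Or.inl (Or.inl (Or.inl (scaleHom_mem_domainAddRel q hc)))
    · exact Or.inl (Or.inl (Or.inr (scaleHom_mem_integrandAddRel q hc)))
    · exact Or.inl (Or.inr (scaleHom_mem_changeOfVariablesRel q hc))
    · exact Or.inr (scaleHom_mem_newtonLeibnizRel q hc)
  exact h ⟨c, hc, rfl⟩

/-- Equivalence is stable under scaling both representations by the same rational.
[cite: KontsevichZagier2001, §1.2] -/
theorem equivalent_scaleRep {n m : ℕ} (q : ℚ) {r : KZ.IntegralRep n} {r' : KZ.IntegralRep m}
    (h : KZ.Equivalent r r') : KZ.Equivalent (scaleRep q r) (scaleRep q r') := by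
  have := scaleHom_mem_relations q h
  simpa [KZ.Equivalent, map_sub] using this

/-! ## §11b Every combination is `k` times its `1/k`-scaling, modulo rule 1b -/

/-- `c ≡ k • S_{1/k} c` modulo rule 1b, for every formal combination `c` and every `k ≥ 1`.
[folklore] -/
theorem sub_nsmul_scaleHom_mem_closure (c : KZ.FormalRep) {k : ℕ} (hk : 0 < k) :
    c - k • scaleHom ((1 : ℚ) / k) c ∈ AddSubgroup.closure KZ.integrandAddRel := by
  induction c using FreeAbelianGroup.induction_on with
  | zero => simp
  | of x =>
    obtain ⟨n, r⟩ := x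
    change KZ.of r - k • scaleHom ((1 : ℚ) / k) (KZ.of r) ∈ _
    rw [scaleHom_of]
    exact of_sub_nsmul_mem_closure_integrandAdd r hk
  | neg x hx =>
    have := AddSubgroup.neg_mem _ hx
    convert this using 1
    rw [map_neg, smul_neg]
    abel
  | add x y hx hy =>
    have := AddSubgroup.add_mem _ hx hy
    convert this using 1
    rw [map_add, nsmul_add]
    abel

/-! ## §11c Saturation -/

/-- **`KZ.relations` is saturated: the quotient of the formal group by the moves is torsion-free.**
If `k • c ∈ relations` (`k ≥ 1`) then `k • S_{1/k} c = S_{1/k} (k • c) ∈ relations`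
(`scaleHom_mem_relations`) and `c ≡ k • S_{1/k} c` (`sub_nsmul_scaleHom_mem_closure`), so
`c ∈ relations`.  Unconditional — cycle 2 had this only from the kernel conjecture
(`saturated_of_kzKernelConjecture`). [folklore] -/
theorem relationsSaturated : RelationsSaturated := by
  intro c k hk hkc
  have h1 : c - k • scaleHom ((1 : ℚ) / k) c ∈ KZ.relations :=
    (AddSubgroup.closure_mono fun x hx => Or.inl (Or.inl (Or.inr hx)))
      (sub_nsmul_scaleHom_mem_closure c hk)
  have h2 : k • scaleHom ((1 : ℚ) / k) c ∈ KZ.relations := by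
    rw [← map_nsmul]
    exact scaleHom_mem_relations _ hkc
  have := KZ.relations.add_mem h1 h2
  simpa using this

/-- `k • c ∈ relations ↔ c ∈ relations` for `k ≥ 1`. [folklore] -/
theorem nsmul_mem_relations_iff {c : KZ.FormalRep} {k : ℕ} (hk : 0 < k) :
    k • c ∈ KZ.relations ↔ c ∈ KZ.relations :=
  ⟨relationsSaturated c k hk, fun h => KZ.relations.nsmul_mem h k⟩

/-- `k • c ∈ relations ↔ c ∈ relations` for every non-zero integer `k`. [folklore] -/
theorem zsmul_mem_relations_iff {c : KZ.FormalRep} {k : ℤ} (hk : k ≠ 0) :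
    k • c ∈ KZ.relations ↔ c ∈ KZ.relations := by
  refine ⟨fun h => ?_, fun h => KZ.relations.zsmul_mem h k⟩
  rcases Int.natAbs_eq k with hk' | hk'
  · rw [hk', natCast_zsmul] at h
    exact relationsSaturated c _ (Int.natAbs_pos.2 hk) h
  · rw [hk', neg_zsmul, natCast_zsmul] at h
    exact relationsSaturated c _ (Int.natAbs_pos.2 hk) (by simpa using KZ.relations.neg_mem h)

/-- **No torsion in `FormalRep ⧸ relations`**: a non-zero class has infinite order. [folklore] -/
theorem not_isOfFinAddOrder_of_not_mem {c : KZ.FormalRep} (hc : c ∉ KZ.relations) :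
    ¬ IsOfFinAddOrder (QuotientAddGroup.mk c : KZ.FormalRep ⧸ KZ.relations) := by
  intro h
  obtain ⟨k, hk, hk0⟩ := h.exists_nsmul_eq_zero
  apply hc
  rw [← QuotientAddGroup.mk_nsmul, QuotientAddGroup.eq_zero_iff] at hk0
  exact relationsSaturated c k hk hk0

/-- **Unique divisibility**: with §6a (`exists_sub_nsmul_mem_relations`) the quotient by the moves
is a UNIQUELY divisible group, i.e. a `ℚ`-vector space. [folklore] -/
theorem existsUnique_div (c : KZ.FormalRep) {k : ℕ} (hk : 0 < k) :
    ∃ d : KZ.FormalRep, c - k • d ∈ KZ.relations ∧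
      ∀ d' : KZ.FormalRep, c - k • d' ∈ KZ.relations → d - d' ∈ KZ.relations := by
  obtain ⟨d, hd⟩ := exists_sub_nsmul_mem_relations c hk
  refine ⟨d, hd, fun d' hd' => relationsSaturated _ k hk ?_⟩
  have := KZ.relations.sub_mem hd' hd
  rw [nsmul_sub]
  convert this using 1
  abel

/-- A `k`-fold chain is as good as a chain: `k • ([r] − [r']) ∈ relations ⇒ r ~ r'`, in every
dimension, for every pair of representations. [folklore] -/
theorem equivalent_of_nsmul_sub_mem {n m : ℕ} (r : KZ.IntegralRep n) (r' : KZ.IntegralRep m)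
    {k : ℕ} (hk : 0 < k) (h : k • (KZ.of r - KZ.of r') ∈ KZ.relations) : KZ.Equivalent r r' :=
  relationsSaturated _ k hk h

/-- **The torsion attack surface of cycle 2 is void**: there is NO pair of representations (of any
dimensions) connected `k` times over but not once; in particular `not_planarAreas_of_torsion` can
never be instantiated. [folklore] -/
theorem no_torsion_witness :
    ¬ ∃ (n m : ℕ) (r : KZ.IntegralRep n) (r' : KZ.IntegralRep m) (k : ℕ), 0 < k ∧
      k • (KZ.of r - KZ.of r') ∈ KZ.relations ∧ KZ.of r - KZ.of r' ∉ KZ.relations :=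
  fun ⟨_, _, r, r', _, hk, h, hnot⟩ => hnot (equivalent_of_nsmul_sub_mem r r' hk h)

end Summit.KontsevichZagierPeriods.PlanarAreas.Negative

end
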